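import Summits.Ventures.HodgeRepro2.T5SU11ResolventSymmetricL2
import Summits.Ventures.HodgeRepro2.T5SU11WeightedSpaceClass
import Summits.Ventures.HodgeRepro2.T5SU11ResolventL2NeumannAll
import Summits.Ventures.HodgeRepro2.T5SU11ResolventGroundStateWeight
import Summits.Ventures.HodgeRepro2.T5SU11WeightedSpaceGroundState
import Summits.Ventures.HodgeRepro2.T5SU11ResolventL1GroundState
import Summits.Ventures.HodgeRepro2.T5SU11ResolventPowerSeriesGroundState

/-!
# Summary XVII — the resolvent on `L²` sources and on the weighted spaces, the ground-state weight `Ξ` and the sharp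
constant `1/(λ − 1)²` (rows 553–559), under uniform names

Throughout `μ = λ(λ − 2)`, `Ξ = φ_1` the ground state, `W_1 = {g continuous on (0, ∞) : |g| ≤ D Ξ}`, and a *source of the
class* is a continuous `g` on `(0, ∞)`, bounded on `(0, 1]`, with `|g(s)| ≤ C e^{−εs}` for large `s` at a rate `ε > 2 − λ`.

* `resolvent_symm_l2` — **`⟨G^I_λ g, h⟩ = ⟨g, G^I_λ h⟩` for two square-integrable sources of the class** (row 553);
* `weighted_mem_class`, `resolvent_mem_weighted` — `{|g| ≤ D φ_{λ′}} ⊂ class` for `1 < λ′ ≤ 2`, and `G^I_λ` maps it into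
  itself with norm `≤ 1/(μ − μ′)` (row 554);
* `l2_iterates_all`, `l2_lipschitz_all`, `neumann_l2_all` — **the `L²` iterates, the `L²` Lipschitz bound and the `L²`
  Neumann series on `|μ − μ₂| < (λ₂ − 1)²` for every square-integrable source of the class** (row 555);
* `kernel_row_sum_ground` — **`∫_s |K_λ(t, s)| Ξ(s) sinh 2s ds = Ξ(t)/(λ − 1)²`** (row 556);
* `ground_mem_class`, `resolvent_mem_ground` — **`W_1 ⊂ class` for every `λ > 1`, and `G^I_λ` maps `W_1` into itself with the
  sharp norm `1/(λ − 1)²`** (row 556);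
* `ground_iterates`, `ground_lipschitz`, `neumann_ground` — the iterates, the Lipschitz bound and the Neumann series on
  `W_1` on the sharp disc `|μ − μ₂| < (λ₂ − 1)²` (row 557);
* `l1_mem_ground`, `l1_bound_ground` — **`∫ |G^I_λ g| Ξ sinh 2t ≤ (∫ |g| Ξ sinh 2s)/(λ − 1)²`** (row 558);
* `neumann_summable_ground`, `neumann_hasSum_ground`, `neumann_tsum_ground` — **`∑' k, (μ − μ₂)^k (G^I_{λ₂})^{k+1} g(t) =
  G^I_λ g(t)` on `W_1`, on the sharp disc** (row 559).

Nothing is claimed about (N).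

Blind lane: Mathlib + the HodgeRepro2 prefix only; no sorry; axioms ⊆ {propext, Classical.choice,
Quot.sound}.
-/

namespace Summit.Ventures.HodgeRepro2.T5SU11RadialSummaryXVII

open Filter Topology MeasureTheory
open Set (Ioi Ioc)
open T5SU11Cartan T5SU11SphericalFunction T5SU11SphericalDecay T5SU11RadialGreenImproper T5SU11RadialGreenKernel
  T5SU11ResolventSymmetricL2 T5SU11WeightedSpaceClass T5SU11ResolventL2NeumannAll T5SU11ResolventGroundStateWeight
  T5SU11WeightedSpaceGroundState T5SU11ResolventL1GroundState T5SU11ResolventPowerSeriesGroundState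

section measure

variable [MeasurableSpace Circle] [BorelSpace Circle]

variable {lam : ℝ} (hlam : 1 < lam) {g : ℝ → ℝ} (hg : ContinuousOn g (Ioi 0))

include hlam hg in
/-- **The resolvent is symmetric on `L²(sinh 2t dt)` for every `λ > 1`** (row 553). -/
theorem resolvent_symm_l2 {lam' : ℝ} (h1 : 1 < lam') (h2 : lam' < lam)
    {M : ℝ} (hM : ∀ s ∈ Ioc (0 : ℝ) 1, |g s| ≤ M) (hM0 : 0 ≤ M)
    {ε C s₀ : ℝ} (hε : 2 - lam < ε) (hC : ∀ s, s₀ ≤ s → |g s| ≤ C * Real.exp (-ε * s))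
    (hg2 : IntegrableOn (fun s => Real.sinh (2 * s) * g s ^ 2) (Ioi 0))
    {h : ℝ → ℝ} (hh : ContinuousOn h (Ioi 0))
    {M' : ℝ} (hM' : ∀ s ∈ Ioc (0 : ℝ) 1, |h s| ≤ M') (hM'0 : 0 ≤ M')
    {ε' C' s₀' : ℝ} (hε' : 2 - lam < ε') (hC' : ∀ s, s₀' ≤ s → |h s| ≤ C' * Real.exp (-ε' * s))
    (hh2 : IntegrableOn (fun s => Real.sinh (2 * s) * h s ^ 2) (Ioi 0)) :
    ∫ t in Ioi 0, greenSolI (fun t => sph lam (hyp t)) (sphDecay lam) g t * h t * Real.sinh (2 * t)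
      = ∫ s in Ioi 0, g s * greenSolI (fun t => sph lam (hyp t)) (sphDecay lam) h s * Real.sinh (2 * s) :=
  inner_greenSolI_symm_l2 hlam h1 h2 hg hM hM0 hε hC hg2 hh hM' hM'0 hε' hC' hh2

/-- **The weighted space `{|g| ≤ D φ_{λ′}}`, `1 < λ′ ≤ 2`, lies in the class** (row 554). -/
theorem weighted_mem_class {lam' : ℝ} (h1 : 1 < lam') (h2' : lam' ≤ 2) {D : ℝ}
    (hD : ∀ s, 0 < s → |g s| ≤ D * sph lam' (hyp s)) :
    (∀ s ∈ Ioc (0 : ℝ) 1, |g s| ≤ D) ∧ 0 ≤ D ∧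
      ∃ K T : ℝ, 0 ≤ K ∧ 0 < T ∧ ∀ s, T ≤ s → |g s| ≤ (D * K) * Real.exp (-(2 - lam') * s) :=
  class_of_le_mul_sph h1 h2' hD

include hlam hg in
/-- **`G^I_λ` maps `{|g| ≤ D φ_{λ′}}` into itself with norm `≤ 1/(μ − μ′)`** (`1 < λ′ ≤ 2`, `λ > λ′`; row 554). -/
theorem resolvent_mem_weighted {lam' : ℝ} (h1 : 1 < lam') (h2 : lam' < lam) (h2' : lam' ≤ 2) {D : ℝ}
    (hD : ∀ s, 0 < s → |g s| ≤ D * sph lam' (hyp s)) :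
    ContinuousOn (greenSolI (fun t => sph lam (hyp t)) (sphDecay lam) g) (Ioi 0) ∧
      ∀ s, 0 < s → |greenSolI (fun t => sph lam (hyp t)) (sphDecay lam) g s|
        ≤ (D / (lam * (lam - 2) - lam' * (lam' - 2))) * sph lam' (hyp s) :=
  greenSolI_mem_weighted hlam h1 h2 h2' hg hD

include hlam hg in
/-- **The `L²` iterates for every square-integrable source of the class** (row 555). -/
theorem l2_iterates_all {M : ℝ} (hM : ∀ s ∈ Ioc (0 : ℝ) 1, |g s| ≤ M) (hM0 : 0 ≤ M)
    {ε C s₀ : ℝ} (hε : 2 - lam < ε) (hC : ∀ s, s₀ ≤ s → |g s| ≤ C * Real.exp (-ε * s))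
    (hg2 : IntegrableOn (fun s => Real.sinh (2 * s) * g s ^ 2) (Ioi 0)) (n : ℕ) :
    IntegrableOn (fun t => Real.sinh (2 * t) * ((greenSolI (fun t => sph lam (hyp t)) (sphDecay lam))^[n] g) t ^ 2)
      (Ioi 0) ∧
    ∫ t in Ioi 0, Real.sinh (2 * t) * ((greenSolI (fun t => sph lam (hyp t)) (sphDecay lam))^[n] g) t ^ 2
      ≤ (∫ t in Ioi 0, Real.sinh (2 * t) * g t ^ 2) / (((lam - 1) ^ 2) ^ 2) ^ n :=
  iterate_l2_all hlam hg hM hM0 hε hC hg2 n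

include hlam hg in
/-- **The `L²` Lipschitz bound in `μ` for every square-integrable source of the class** (row 555). -/
theorem l2_lipschitz_all {M : ℝ} (hM : ∀ s ∈ Ioc (0 : ℝ) 1, |g s| ≤ M) (hM0 : 0 ≤ M)
    {ε C s₀ : ℝ} (hε : 2 - lam < ε) (hC : ∀ s, s₀ ≤ s → |g s| ≤ C * Real.exp (-ε * s))
    (hg2 : IntegrableOn (fun s => Real.sinh (2 * s) * g s ^ 2) (Ioi 0))
    {lam₂ : ℝ} (hlam₂ : 1 < lam₂) (hε₂ : 2 - lam₂ < ε) :
    ∫ t in Ioi 0, Real.sinh (2 * t) * (greenSolI (fun t => sph lam (hyp t)) (sphDecay lam) g t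
        - greenSolI (fun t => sph lam₂ (hyp t)) (sphDecay lam₂) g t) ^ 2
      ≤ (lam * (lam - 2) - lam₂ * (lam₂ - 2)) ^ 2 * (∫ t in Ioi 0, Real.sinh (2 * t) * g t ^ 2)
          / (((lam - 1) ^ 2) ^ 2 * ((lam₂ - 1) ^ 2) ^ 2) :=
  integral_sinh_mul_sub_sq_le_all hlam hg hM hM0 hε hC hg2 hlam₂ hε₂

include hlam hg in
/-- **The Neumann series converges in `L²` on `|μ − μ₂| < (λ₂ − 1)²` for every square-integrable source of the class**
(row 555). -/
theorem neumann_l2_all {M : ℝ} (hM : ∀ s ∈ Ioc (0 : ℝ) 1, |g s| ≤ M) (hM0 : 0 ≤ M)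
    {ε C s₀ : ℝ} (hε : 2 - lam < ε) (hC : ∀ s, s₀ ≤ s → |g s| ≤ C * Real.exp (-ε * s))
    (hg2 : IntegrableOn (fun s => Real.sinh (2 * s) * g s ^ 2) (Ioi 0))
    {lam₂ : ℝ} (hlam₂ : 1 < lam₂) (hε₂ : 2 - lam₂ < ε)
    (hq : |lam * (lam - 2) - lam₂ * (lam₂ - 2)| < (lam₂ - 1) ^ 2) :
    Tendsto (fun n : ℕ => ∫ t in Ioi 0, Real.sinh (2 * t) * (greenSolI (fun t => sph lam (hyp t)) (sphDecay lam) g t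
        - ∑ k ∈ Finset.range (n + 1), (lam * (lam - 2) - lam₂ * (lam₂ - 2)) ^ k
          * (greenSolI (fun t => sph lam₂ (hyp t)) (sphDecay lam₂))^[k + 1] g t) ^ 2) atTop (𝓝 0) :=
  tendsto_neumann_l2_all hlam hg hM hM0 hε hC hg2 hlam₂ hε₂ hq

include hlam in
/-- **The weighted row sums at the ground state**: `∫_{(0,∞)} |K_λ(t, s)| Ξ(s) sinh 2s ds = Ξ(t)/(λ − 1)²` (row 556). -/
theorem kernel_row_sum_ground {t : ℝ} (ht : 0 < t) :
    ∫ s in Ioi 0, |sphGreenKernel lam t s| * sph 1 (hyp s) * Real.sinh (2 * s) = sph 1 (hyp t) / (lam - 1) ^ 2 :=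
  integral_abs_sphGreenKernel_mul_sph_one hlam ht

include hlam in
/-- **`W_1 ⊂ class` for every `λ > 1`** (row 556). -/
theorem ground_mem_class {D : ℝ} (hD : ∀ s, 0 < s → |g s| ≤ D * sph 1 (hyp s)) :
    (∀ s ∈ Ioc (0 : ℝ) 1, |g s| ≤ D) ∧ 0 ≤ D ∧ 2 - lam < (3 - lam) / 2 ∧
      ∃ C : ℝ, ∀ s, (1 : ℝ) ≤ s → |g s| ≤ (D * C) * Real.exp (-((3 - lam) / 2) * s) :=
  class_of_le_mul_sph_one hlam hD

include hlam hg in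
/-- **`G^I_λ` maps `W_1` into itself with the sharp norm `1/(λ − 1)²`** (row 556). -/
theorem resolvent_mem_ground {D : ℝ} (hD : ∀ s, 0 < s → |g s| ≤ D * sph 1 (hyp s)) :
    ContinuousOn (greenSolI (fun t => sph lam (hyp t)) (sphDecay lam) g) (Ioi 0) ∧
      ∀ s, 0 < s → |greenSolI (fun t => sph lam (hyp t)) (sphDecay lam) g s| ≤ (D / (lam - 1) ^ 2) * sph 1 (hyp s) :=
  greenSolI_mem_weighted_one hlam hg hD

include hlam hg in
/-- **The iterates on `W_1`**: `|(G^I_λ)ⁿ g(t)| ≤ D Ξ(t)/((λ − 1)²)ⁿ` (row 557). -/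
theorem ground_iterates {D : ℝ} (hD : ∀ s, 0 < s → |g s| ≤ D * sph 1 (hyp s)) (n : ℕ) :
    ContinuousOn ((greenSolI (fun t => sph lam (hyp t)) (sphDecay lam))^[n] g) (Ioi 0) ∧
      ∀ t, 0 < t → |((greenSolI (fun t => sph lam (hyp t)) (sphDecay lam))^[n] g) t|
        ≤ D * sph 1 (hyp t) / ((lam - 1) ^ 2) ^ n :=
  iterate_mem_weighted_one hlam hg hD n

include hlam hg in
/-- **The Lipschitz bound in `μ` on `W_1`** (row 557). -/
theorem ground_lipschitz {D : ℝ} (hD : ∀ s, 0 < s → |g s| ≤ D * sph 1 (hyp s)) {lam₂ : ℝ} (hlam₂ : 1 < lam₂)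
    {t : ℝ} (ht : 0 < t) :
    |greenSolI (fun t => sph lam (hyp t)) (sphDecay lam) g t - greenSolI (fun t => sph lam₂ (hyp t)) (sphDecay lam₂) g t|
      ≤ |lam * (lam - 2) - lam₂ * (lam₂ - 2)| * D * sph 1 (hyp t) / ((lam - 1) ^ 2 * (lam₂ - 1) ^ 2) :=
  abs_greenSolI_sub_le_mul_sph_one hlam hg hD hlam₂ ht

include hlam hg in
/-- **The Neumann series converges in the `Ξ`-weighted sup-norm on the sharp disc `|μ − μ₂| < (λ₂ − 1)²`** (row 557). -/
theorem neumann_ground {D : ℝ} (hD : ∀ s, 0 < s → |g s| ≤ D * sph 1 (hyp s)) {lam₂ : ℝ} (hlam₂ : 1 < lam₂)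
    (hq : |lam * (lam - 2) - lam₂ * (lam₂ - 2)| < (lam₂ - 1) ^ 2) :
    Tendsto (fun n : ℕ => (|lam * (lam - 2) - lam₂ * (lam₂ - 2)| / (lam₂ - 1) ^ 2) ^ (n + 1) * (D / (lam - 1) ^ 2))
      atTop (𝓝 0) ∧
    ∀ n : ℕ, ∀ t, 0 < t → |greenSolI (fun t => sph lam (hyp t)) (sphDecay lam) g t
        - ∑ k ∈ Finset.range (n + 1), (lam * (lam - 2) - lam₂ * (lam₂ - 2)) ^ k
          * (greenSolI (fun t => sph lam₂ (hyp t)) (sphDecay lam₂))^[k + 1] g t|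
      ≤ ((|lam * (lam - 2) - lam₂ * (lam₂ - 2)| / (lam₂ - 1) ^ 2) ^ (n + 1) * (D / (lam - 1) ^ 2)) * sph 1 (hyp t) :=
  tendsto_neumann_weighted_one hlam hg hD hlam₂ hq

include hlam hg in
/-- **The resolvent preserves `L¹(Ξ sinh 2t dt)` for every `λ > 1`** (row 558). -/
theorem l1_mem_ground {M : ℝ} (hM : ∀ s ∈ Ioc (0 : ℝ) 1, |g s| ≤ M) (hM0 : 0 ≤ M)
    {ε C s₀ : ℝ} (hε : 2 - lam < ε) (hC : ∀ s, s₀ ≤ s → |g s| ≤ C * Real.exp (-ε * s))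
    (hg1 : IntegrableOn (fun s => |g s| * sph 1 (hyp s) * Real.sinh (2 * s)) (Ioi 0)) :
    IntegrableOn (fun t => greenSolI (fun t => sph lam (hyp t)) (sphDecay lam) g t * sph 1 (hyp t)
      * Real.sinh (2 * t)) (Ioi 0) :=
  integrableOn_greenSolI_mul_sph_one_mul_sinh hlam hg hM hM0 hε hC hg1

include hlam hg in
/-- **The sharp `L¹(Ξ sinh 2t dt)` bound `1/(λ − 1)²`** (row 558). -/
theorem l1_bound_ground {M : ℝ} (hM : ∀ s ∈ Ioc (0 : ℝ) 1, |g s| ≤ M) (hM0 : 0 ≤ M)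
    {ε C s₀ : ℝ} (hε : 2 - lam < ε) (hC : ∀ s, s₀ ≤ s → |g s| ≤ C * Real.exp (-ε * s))
    (hg1 : IntegrableOn (fun s => |g s| * sph 1 (hyp s) * Real.sinh (2 * s)) (Ioi 0)) :
    ∫ t in Ioi 0, |greenSolI (fun t => sph lam (hyp t)) (sphDecay lam) g t| * sph 1 (hyp t) * Real.sinh (2 * t)
      ≤ (∫ s in Ioi 0, |g s| * sph 1 (hyp s) * Real.sinh (2 * s)) / (lam - 1) ^ 2 :=
  integral_abs_greenSolI_mul_sph_one_mul_sinh_le hlam hg hM hM0 hε hC hg1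

include hg in
/-- **The Neumann series is absolutely summable on `W_1` on the sharp disc** (row 559). -/
theorem neumann_summable_ground {D : ℝ} (hD : ∀ s, 0 < s → |g s| ≤ D * sph 1 (hyp s)) {lam₂ : ℝ} (hlam₂ : 1 < lam₂)
    (hq : |lam * (lam - 2) - lam₂ * (lam₂ - 2)| < (lam₂ - 1) ^ 2) {t : ℝ} (ht : 0 < t) :
    Summable (fun k : ℕ => (lam * (lam - 2) - lam₂ * (lam₂ - 2)) ^ k
      * (greenSolI (fun t => sph lam₂ (hyp t)) (sphDecay lam₂))^[k + 1] g t) :=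
  summable_neumann_weighted_one (lam := lam) hlam₂ hg hD hq ht

include hlam hg in
/-- **`HasSum` of the Neumann series to `G^I_λ g(t)` on `W_1`** (row 559). -/
theorem neumann_hasSum_ground {D : ℝ} (hD : ∀ s, 0 < s → |g s| ≤ D * sph 1 (hyp s)) {lam₂ : ℝ} (hlam₂ : 1 < lam₂)
    (hq : |lam * (lam - 2) - lam₂ * (lam₂ - 2)| < (lam₂ - 1) ^ 2) {t : ℝ} (ht : 0 < t) :
    HasSum (fun k : ℕ => (lam * (lam - 2) - lam₂ * (lam₂ - 2)) ^ k
      * (greenSolI (fun t => sph lam₂ (hyp t)) (sphDecay lam₂))^[k + 1] g t)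
      (greenSolI (fun t => sph lam (hyp t)) (sphDecay lam) g t) :=
  hasSum_neumann_weighted_one hlam hlam₂ hg hD hq ht

include hlam hg in
/-- **`∑' k, (μ − μ₂)^k (G^I_{λ₂})^{k+1} g(t) = G^I_λ g(t)` on `W_1`, on the sharp disc** (row 559). -/
theorem neumann_tsum_ground {D : ℝ} (hD : ∀ s, 0 < s → |g s| ≤ D * sph 1 (hyp s)) {lam₂ : ℝ} (hlam₂ : 1 < lam₂)
    (hq : |lam * (lam - 2) - lam₂ * (lam₂ - 2)| < (lam₂ - 1) ^ 2) {t : ℝ} (ht : 0 < t) :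
    ∑' k : ℕ, (lam * (lam - 2) - lam₂ * (lam₂ - 2)) ^ k
      * (greenSolI (fun t => sph lam₂ (hyp t)) (sphDecay lam₂))^[k + 1] g t
      = greenSolI (fun t => sph lam (hyp t)) (sphDecay lam) g t :=
  tsum_neumann_weighted_one hlam hlam₂ hg hD hq ht

end measure

end Summit.Ventures.HodgeRepro2.T5SU11RadialSummaryXVII
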